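import Summits.BirchSwinnertonDyer.BirchSwinnertonDyer.Theses.ShadowIsolation
import Summits.BirchSwinnertonDyer.BirchSwinnertonDyer.Theses.SelmerRank
import Summits.BirchSwinnertonDyer.BirchSwinnertonDyer.Theses.Squeeze
import Summits.BirchSwinnertonDyer.BirchSwinnertonDyer.Theses.TangentCone
import Summits.BirchSwinnertonDyer.BirchSwinnertonDyer.Theorems.SelmerRankShaCorank
import Literature.NumberTheory.EllipticCurves.SerreOpenImageFinalProofs
import Literature.NumberTheory.EllipticCurves.SupersingularDensityProofs
import Literature.NumberTheory.EllipticCurves.NonEisensteinPrimeOfSurjective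
import Literature.NumberTheory.EllipticCurves.BSDSelmerParityDokchitserProofs
import HarnessLib

/-!
# Line `greenberg-split` — crux `SelmerRankUB` (stmt-BirchSwinnertonDyer-0130)

Crux (route ShadowIsolation #4; byte-identical decl route SelmerRank #3): **upper half of
Selmer-rank BSD at a big-image good ordinary prime**,
`∀ W elliptic, globally minimal, p prime, 5 ≤ p → good at p → p ∤ a_p → ρ̄_{E,p} surjective →
corank_{ℤ_p} Sel_{p^∞}(E/ℚ) ≤ ord_{s=1} L(E,s)`.

## The lever (crux-strategist s2, lens DECOMPOSITION, 2026-08-17)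

Greenberg's identity `corank_{ℤ_p} Sel_{p^∞}(E/ℚ) = rank E(ℚ) + corank_{ℤ_p} Ш(E/ℚ)[p^∞]`
(tree THEOREM `WeierstrassCurve.selmerCorank_eq_mordellWeilRank_add_holds`) splits the crux into an
ARCHIMEDEAN half (no excess rank: `rank ≤ r_an`) and a Ш-HALF (no divisible `Ш[p^∞]` at a big-image
good ordinary `p`). On the two routes wanting the crux the Ш-half is ALREADY CARRIED:

* route **ShadowIsolation**: its own cruxes #2 `IsolationOfAccidentalZeros` and #3 `PhantomShadow`
  give `corank Ш[p^∞] = 0` at every good ordinary `p ≥ 5` with `E[p]` IRREDUCIBLE (the first half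
  of its target `ShadowIsolationThesis`, glue `CruxesToTarget`), and surjective ⇒ irreducible
  (tree theorem `hasIrreducibleModPGaloisRep_of_hasSurjectiveModNGaloisRep`) — proved below as
  `shaCotorsionBigImage_of_shadowIsolation` (the support item `ShaUnboundedOfCorank` it needs is
  PROVED here, `shaUnboundedOfCorank_holds`, verbatim the algebra of the route's certified `closes`);
* route **SelmerRank**: its crux #5 `SelmerRankShaPFinite` (stmt-0132) —
  `shaCotorsionBigImage_of_shaPFinite`.

Hence on either route the crux costs EXACTLY its archimedean half `stub_noExcessRankBigImage`
("no elliptic curve over ℚ with a big-image good ordinary prime ≥ 5 and analytic rank ≥ 2 has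
rank > analytic rank"), which is (i) implied by the crux itself (`noExcessRankBigImage_of_selmerRankUB`:
the stub is the crux's rank part, not a costume of it — it drops the Ш-term), (ii) implied by the
sibling item `SqueezeUB` (stmt-0145 LeadingTerm.SqueezeUBR2 / stmt-0496 Squeeze.SqueezeUB =
HigherGrossZagier.SqueezeUB: `∀ W, rank ≤ r_an`) restricted to non-CM curves
(`noExcessRankBigImage_of_squeezeUB`), and (iii) implied by route TangentCone's pair
`EdgeDecay ∧ EdgeCap` ALONE (`noExcessRankBigImage_of_edge`: the two-variable edge squeeze caps
`corank_q ≤ r_an` at one admissible prime `q`, and `rank ≤ corank_q`). Modulo the Ш-half and the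
Gross–Zagier–Kolyvagin cell the crux is EQUIVALENT to that stub (`selmerRankUB_iff_noExcess`).
CM curves are out of scope of the crux (no surjective `ρ̄_{E,p}`, `p ≥ 3`, on a CM curve —
Serre 1972 §4.5), so the residual is the NON-CM case of `SqueezeUB`'s open core `UBE4`
(`Cruxes/SqueezeUB/STRATEGY-CENSUS.md` v3: first cell "four independent points ⇒ L''(E,1) = 0").

## Stubs (3; registered by `ledger skeleton check`)

* `stub_gzkSelmerCell` (LITERATURE DEBT, image-free): `r_an ≤ 1 → corank_p ≤ r_an` at every
  prime — Kato (r_an = 0) / Gross–Zagier–Kolyvagin (r_an = 1) with the corank identity; in tree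
  modulo the named fact `rank_eq_analyticRank_of_analyticRank_le_one` (= TangentCone's item
  `RankLeOne` verbatim): `gzkSelmerCell_of_fact`, `gzkSelmerCell_of_rankLeOne`.
* `stub_noExcessRankBigImage` (OPEN — the crux's residual on both routes): for `W` globally
  minimal elliptic with a big-image good ordinary `p ≥ 5` and `r_an ≥ 2`, `rank ≤ r_an`.
  Known: nothing beyond `SqueezeUB`'s cells (GZK; parity is NOT available for `rank`, only for
  `corank`); first open cell: rank 4, `r_an = 2`, `w = +1`. Discharged by stmt-0145/0496
  (`SqueezeUB`) and by TangentCone `EdgeDecay ∧ EdgeCap`.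
* `stub_shaCotorsionBigImage` (Ш-HALF; discharged on ShadowIsolation by `Iso ∧ Shadow`, on
  SelmerRank by `SelmerRankShaPFinite`; not to be staffed on its own): same binders,
  `corank_{ℤ_p} Ш[p^∞] = 0`.

`SelmerRankUB_of : stub_gzkSelmerCell → stub_noExcessRankBigImage → stub_shaCotorsionBigImage →
ShadowIsolation.SelmerRankUB` is sorry-free (case `r_an ≤ 1`: GZK cell; else Greenberg's identity,
Ш-half, archimedean half). `SelmerRankUB_proofSelmerRank` is the same composition under route
SelmerRank's decl name.

Disproof used: none on file (`ledger crux ls stmt-BirchSwinnertonDyer-0130`: no workfiles,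
2026-08-17; payload carries no `disproof_path`). Negatives index (1 entry,
`LeadingTermTamePinch_refuted`: CM curves `y² = x³ − n²x` have no ADMISSIBLE prime for
`IsOrdinaryAt` + surjectivity) — honoured: no stub asserts a prime SUPPLY; every stub is
conditional on a given big-image good ordinary `p`, and the only supply used (in the converse
remark `squeezeUB_nonCM_of_selmerRankUB`) is the PROVED Serre supply (`serre_open_image_holds` +
`infinite_goodOrdinaryPrimes_holds`, as in `Theorems.exists_goodOrdinary_surjective_of_not_hasCM`).
-/

set_option linter.dupNamespace false

namespace Summit.BirchSwinnertonDyer.BirchSwinnertonDyer.Cruxes.SelmerRankUB.GreenbergSplit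

open Summit.BirchSwinnertonDyer.BirchSwinnertonDyer.Theses.ShadowIsolation (SelmerRankUB)

/-! ### Registered stubs -/

/-- Stub **GZK-SELMER CELL** (literature debt, image-free): if `ord_{s=1} L(E,s) ≤ 1` then
`corank_{ℤ_p} Sel_{p^∞}(E/ℚ) ≤ ord_{s=1} L(E,s)` for every prime `p` — Kato (`r_an = 0`:
`L(E,1) ≠ 0 ⇒ Sel_{p^∞}` finite) and Gross–Zagier–Kolyvagin (`r_an = 1`: rank `1`, `Ш` finite)
with Greenberg's corank identity; in tree modulo the named fact
`rank_eq_analyticRank_of_analyticRank_le_one` (`gzkSelmerCell_of_fact`). [cite: Darmon2004, Thm. 3.22] -/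
theorem stub_gzkSelmerCell :
    ∀ (W : WeierstrassCurve ℚ) [W.IsElliptic] (p : ℕ) [Fact p.Prime],
      W.analyticRank ≤ 1 → W.selmerCorank p ≤ W.analyticRank := by
  sorry

/-- Stub **NO-EXCESS-RANK, big image** (OPEN; the crux's residual on both wanting routes): for an
elliptic `E/ℚ` (globally minimal `W`) with a good ordinary prime `p ≥ 5` at which `ρ̄_{E,p}` is
surjective (so `E` has no CM) and `ord_{s=1} L(E,s) ≥ 2`, `rank E(ℚ) ≤ ord_{s=1} L(E,s)`.
Implied by the crux (`noExcessRankBigImage_of_selmerRankUB`), by the sibling item `SqueezeUB`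
(stmt-0145/0496; `noExcessRankBigImage_of_squeezeUB`) and by TangentCone's `EdgeDecay ∧ EdgeCap`
(`noExcessRankBigImage_of_edge`). First open cell: four independent rational points, `w = +1`,
`L(E,1) = L'(E,1) = 0 ⇒ L''(E,1) = 0`. [cite: GreenbergLNM1716, §1] -/
theorem stub_noExcessRankBigImage :
    ∀ (W : WeierstrassCurve ℚ) [W.IsElliptic] [W.IsGloballyMinimal] (p : ℕ) [Fact p.Prime],
      5 ≤ p → W.HasGoodReductionAtPrime p → ¬ (p : ℤ) ∣ W.frobeniusTrace p →
        W.HasSurjectiveModNGaloisRep p → 2 ≤ W.analyticRank →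
          W.mordellWeilRank ≤ W.analyticRank := by
  sorry

/-- Stub **Ш-COTORSION, big image** (the Ш-half; discharged on route ShadowIsolation by its cruxes
`IsolationOfAccidentalZeros ∧ PhantomShadow` — `shaCotorsionBigImage_of_shadowIsolation` — and on
route SelmerRank by `SelmerRankShaPFinite` — `shaCotorsionBigImage_of_shaPFinite`; not to be
staffed on its own): for `W` globally minimal elliptic, `p ≥ 5` good ordinary with `ρ̄_{E,p}`
surjective and `ord_{s=1} L(E,s) ≥ 2`, the `ℤ_p`-corank of `Ш(E/ℚ)[p^∞]` is `0` (no divisible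
`p`-primary Ш). [cite: GreenbergLNM1716, §1] -/
theorem stub_shaCotorsionBigImage :
    ∀ (W : WeierstrassCurve ℚ) [W.IsElliptic] [W.IsGloballyMinimal] (p : ℕ) [Fact p.Prime],
      5 ≤ p → W.HasGoodReductionAtPrime p → ¬ (p : ℤ) ∣ W.frobeniusTrace p →
        W.HasSurjectiveModNGaloisRep p → 2 ≤ W.analyticRank → W.shaCorank p = 0 := by
  sorry

/-! ### Stub statements by name

The skeleton gate reads the composition's hypotheses BY NAME: each must be a declared stub. The
`abbrev`s below are the stubs' exact elaborated types (`type_of%`). -/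

namespace Statement

/-- Statement of `stub_gzkSelmerCell`. -/
abbrev stub_gzkSelmerCell : Prop := type_of% @GreenbergSplit.stub_gzkSelmerCell
/-- Statement of `stub_noExcessRankBigImage`. -/
abbrev stub_noExcessRankBigImage : Prop := type_of% @GreenbergSplit.stub_noExcessRankBigImage
/-- Statement of `stub_shaCotorsionBigImage`. -/
abbrev stub_shaCotorsionBigImage : Prop := type_of% @GreenbergSplit.stub_shaCotorsionBigImage

end Statement

/-! ### The crux from the stubs (kernel-checked composition, no `sorry`) -/

/-- **The crux BY NAME from the three stub statements** (`ShadowIsolation.SelmerRankUB`): if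
`r_an ≤ 1` the GZK-Selmer cell; else Greenberg's identity `corank Sel_{p^∞} = rank + corank Ш[p^∞]`
(tree theorem `selmerCorank_eq_mordellWeilRank_add_holds`), the Ш-half kills the second summand and
the archimedean half bounds the first. [cite: GreenbergLNM1716, §1] -/
theorem SelmerRankUB_of (hGZK : Statement.stub_gzkSelmerCell)
    (hRank : Statement.stub_noExcessRankBigImage) (hSha : Statement.stub_shaCotorsionBigImage) :
    SelmerRankUB := by
  intro W _ _ p _ h5 hgood hord hsurj
  by_cases h1 : W.analyticRank ≤ 1
  · exact hGZK W p h1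
  · have h2 : 2 ≤ W.analyticRank := by omega
    rw [W.selmerCorank_eq_mordellWeilRank_add_holds p, hSha W p h5 hgood hord hsurj h2, add_zero]
    exact hRank W p h5 hgood hord hsurj h2

/-- The crux along this line (route `ShadowIsolation` decl, by name), MODULO exactly the three
registered stubs (depends on `sorryAx` only through `stub_*`). [folklore] -/
theorem SelmerRankUB_proof : SelmerRankUB :=
  SelmerRankUB_of stub_gzkSelmerCell stub_noExcessRankBigImage stub_shaCotorsionBigImage

/-- The same composition under the byte-identical decl of route `SelmerRank` (the item's primary
route). [folklore] -/
theorem SelmerRankUB_ofSelmerRank (hGZK : Statement.stub_gzkSelmerCell)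
    (hRank : Statement.stub_noExcessRankBigImage) (hSha : Statement.stub_shaCotorsionBigImage) :
    Summit.BirchSwinnertonDyer.BirchSwinnertonDyer.Theses.SelmerRank.SelmerRankUB :=
  fun W _ _ p _ h5 hgood hord hsurj => SelmerRankUB_of hGZK hRank hSha W p h5 hgood hord hsurj

/-- The crux under route `SelmerRank`'s decl name, modulo the three stubs. [folklore] -/
theorem SelmerRankUB_proofSelmerRank :
    Summit.BirchSwinnertonDyer.BirchSwinnertonDyer.Theses.SelmerRank.SelmerRankUB :=
  SelmerRankUB_ofSelmerRank stub_gzkSelmerCell stub_noExcessRankBigImage stub_shaCotorsionBigImage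

/-! ### Exactness and discharges (all PROVED; informative for the lead — these are not stubs)

* the archimedean stub is NECESSARY (`noExcessRankBigImage_of_selmerRankUB`) and, modulo the
  Ш-half and the GZK cell, SUFFICIENT (`selmerRankUB_iff_noExcess`): it is the crux's exact
  residual;
* the Ш-half is the wanting routes' own business (`shaCotorsionBigImage_of_shadowIsolation`,
  `shaCotorsionBigImage_of_shaPFinite`);
* the archimedean stub is discharged by `SqueezeUB` (stmt-0145/0496) and by TangentCone's
  `EdgeDecay ∧ EdgeCap`;
* net debt per route: `selmerRankUB_of_shadowIsolation_items` (Iso, Shadow + SqueezeUB + GZK fact),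
  `selmerRankUB_of_shadowIsolation_edge` (Iso, Shadow + EdgeDecay, EdgeCap + RankLeOne),
  `selmerRankUB_of_selmerRank_items` (ShaPFinite + SqueezeUB + GZK fact);
* conversely the crux gives back `SqueezeUB` for non-CM curves (`squeezeUB_nonCM_of_selmerRankUB`,
  through the PROVED Serre supply `serre_open_image_holds` + `infinite_goodOrdinaryPrimes_holds`). -/

section Discharges

open Summit.BirchSwinnertonDyer.BirchSwinnertonDyer.Theses

/-- GZK-Selmer cell = the tree corollary of the Gross–Zagier–Kolyvagin named fact
(`selmerCorank_eq_analyticRank_of_analyticRank_le_one`). [cite: Darmon2004, Thm. 3.22] -/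
theorem gzkSelmerCell_of_fact
    (hGZK : Literature.NumberTheory.EllipticCurves.rank_eq_analyticRank_of_analyticRank_le_one) :
    Statement.stub_gzkSelmerCell :=
  fun W _ p _ h =>
    (Literature.NumberTheory.EllipticCurves.selmerCorank_eq_analyticRank_of_analyticRank_le_one
      hGZK W p h).le

/-- GZK-Selmer cell from route TangentCone's item `RankLeOne` (stmt-16219 family; the same
statement as the named fact). [cite: Darmon2004, Thm. 3.22] -/
theorem gzkSelmerCell_of_rankLeOne (h : TangentCone.RankLeOne) : Statement.stub_gzkSelmerCell :=
  gzkSelmerCell_of_fact fun W _ hW => h W hW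

/-- **NO-EXCESS is discharged by the sibling item `SqueezeUB`** (`∀ W elliptic, rank ≤ r_an`;
stmt-0496 Squeeze / HigherGrossZagier, stmt-0145 LeadingTerm.SqueezeUBR2, byte-identical bodies):
instantiate and forget the prime. [folklore] -/
theorem noExcessRankBigImage_of_squeezeUB (h : Squeeze.SqueezeUB) :
    Statement.stub_noExcessRankBigImage :=
  fun W _ _ _ _ _ _ _ _ _ => h W

/-- **Conversely the crux gives NO-EXCESS** (`rank ≤ rank + corank Ш[p^∞] = corank Sel_{p^∞} ≤
r_an`): the stub is the crux's rank part — weaker than the crux, not a restatement. [cite: GreenbergLNM1716, §1] -/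
theorem noExcessRankBigImage_of_selmerRankUB (hUB : SelmerRankUB) :
    Statement.stub_noExcessRankBigImage := by
  intro W _ _ p _ h5 hgood hord hsurj _
  have h := hUB W p h5 hgood hord hsurj
  rw [W.selmerCorank_eq_mordellWeilRank_add_holds p] at h
  omega

/-- **Exactness.** Modulo the Ш-half and the GZK cell, the crux is EQUIVALENT to the archimedean
stub. [cite: GreenbergLNM1716, §1] -/
theorem selmerRankUB_iff_noExcess (hGZK : Statement.stub_gzkSelmerCell)
    (hSha : Statement.stub_shaCotorsionBigImage) :
    SelmerRankUB ↔ Statement.stub_noExcessRankBigImage :=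
  ⟨noExcessRankBigImage_of_selmerRankUB, fun hR => SelmerRankUB_of hGZK hR hSha⟩

/-- Surjective ⇒ irreducible mod `p` (tree theorem, Serre 1972 §4; `NeZero (p : ℚ)` from
`p` prime). [cite: Serre1972, §4] -/
theorem irreducible_of_surjective (W : WeierstrassCurve ℚ) [W.IsElliptic] (p : ℕ) [Fact p.Prime]
    (h : W.HasSurjectiveModNGaloisRep p) : W.HasIrreducibleModPGaloisRep p := by
  haveI : NeZero (p : ℚ) := ⟨by exact_mod_cast (Fact.out : p.Prime).ne_zero⟩
  exact Literature.NumberTheory.EllipticCurves.hasIrreducibleModPGaloisRep_of_hasSurjectiveModNGaloisRep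
    W p h

/-- **Route ShadowIsolation's support item `ShaUnboundedOfCorank` HOLDS** (stmt-15490; pure
algebra of the corank formula `zpCorank A p = dim A[p] − dim A/pA`, Greenberg 1999 §1 — verbatim
the argument of the route's certified `closes`, with the finite-group step taken from the landed
`Literature.BSD.zpCorank_eq_zero_of_finite`): if `shaCorank W p ≠ 0` then `Ш(W)` has an element
of every exact order `p ^ n`. [cite: GreenbergLNM1716, §1] -/
theorem shaUnboundedOfCorank_holds : ShadowIsolation.ShaUnboundedOfCorank := by
  classical
  intro W _ p hp hcor n
  have hpp : p.Prime := hp.out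
  by_contra hno
  push Not at hno
  apply hcor
  -- the `p`-primary part `A = Ш[p^∞]` of `Ш(W)`
  set A : AddSubgroup ↥W.sha := AddCommGroup.primaryComponent (↥W.sha) p
  show Literature.NumberTheory.EllipticCurves.zpCorank (↥A) p = 0
  -- (B1) `p ^ n` kills `A`
  have hkill : ∀ a : ↥A, p ^ n • a = 0 := by
    intro a
    obtain ⟨k, hk⟩ : ∃ k : ℕ, p ^ k • (a : ↥W.sha) = 0 := a.2
    have hdvd : addOrderOf (a : ↥W.sha) ∣ p ^ k := addOrderOf_dvd_of_nsmul_eq_zero hk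
    obtain ⟨m, -, hm⟩ := (Nat.dvd_prime_pow hpp).1 hdvd
    by_cases hmn : n ≤ m
    · exfalso
      have hne : addOrderOf (a : ↥W.sha) ≠ 0 := by rw [hm]; exact pow_ne_zero _ hpp.ne_zero
      have hdiv : p ^ n ∣ addOrderOf (a : ↥W.sha) := by rw [hm]; exact pow_dvd_pow p hmn
      exact hno _ (addOrderOf_nsmul_addOrderOf_sub hne hdiv)
    · push Not at hmn
      have hdiv : addOrderOf (a : ↥W.sha) ∣ p ^ n := by rw [hm]; exact pow_dvd_pow p hmn.le
      apply Subtype.ext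
      rw [AddSubgroupClass.coe_nsmul, ZeroMemClass.coe_zero]
      exact addOrderOf_dvd_iff_nsmul_eq_zero.mp hdiv
  -- (B2) `A[p]` is finite: otherwise its `finrank` is the junk value `0` and the corank formula is `0`
  haveI hfinp : Finite ↥(AddSubgroup.torsionBy (↥A) (p : ℤ)) := by
    by_contra hinf
    apply hcor
    show Literature.NumberTheory.EllipticCurves.zpCorank (↥A) p = 0
    unfold Literature.NumberTheory.EllipticCurves.zpCorank
    letI : Module (ZMod p) (AddSubgroup.torsionBy (↥A) (p : ℤ)) := AddSubgroup.torsionBy.zmodModule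
    have h0 : Module.finrank (ZMod p) (AddSubgroup.torsionBy (↥A) (p : ℤ)) = 0 := by
      apply Module.finrank_of_not_finite
      intro hf
      exact hinf (Module.finite_of_finite (ZMod p))
    rw [h0, Nat.zero_sub]
  -- (B3) hence `A = A[p^n]` is finite and a finite group has corank formula `0`
  haveI : Finite ↥(AddSubgroup.torsionBy (↥A) ((p ^ n : ℕ) : ℤ)) :=
    Literature.NumberTheory.EllipticCurves.finite_torsionBy_pow (↥A) p n
  haveI : Finite ↥A :=
    Finite.of_injective
      (fun a : ↥A => (⟨a, AddSubgroup.torsionBy.nsmul_iff.mpr (hkill a)⟩ :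
        ↥(AddSubgroup.torsionBy (↥A) ((p ^ n : ℕ) : ℤ))))
      (fun a b h => by simpa using congrArg Subtype.val h)
  exact Literature.BSD.zpCorank_eq_zero_of_finite (↥A) p

/-- **Ш-cotorsion at every IRREDUCIBLE good ordinary `p ≥ 5` from route ShadowIsolation's cruxes**
(`IsolationOfAccidentalZeros`, `PhantomShadow`; contrapositive: a positive Ш-corank gives elements
of every order `p ^ n` (`shaUnboundedOfCorank_holds`), Shadow gives an accidental zero at every
depth, contradicting Isolation — the first half of the route's glue `CruxesToTarget`). [folklore] -/
theorem shaCotorsion_irreducible_of_shadowIsolation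
    (hIso : ShadowIsolation.IsolationOfAccidentalZeros) (hSh : ShadowIsolation.PhantomShadow) :
    ∀ (W : WeierstrassCurve ℚ) [W.IsElliptic] [W.IsGloballyMinimal] (p : ℕ) [Fact p.Prime],
      5 ≤ p → W.HasGoodReductionAtPrime p → ¬ (p : ℤ) ∣ W.frobeniusTrace p →
        W.HasIrreducibleModPGaloisRep p → W.shaCorank p = 0 := by
  intro W _ _ p _ h5 hgood hord hirr
  by_contra hne
  obtain ⟨n₀, hn₀⟩ := hIso W p h5 hgood hord hirr
  obtain ⟨σ, hσ⟩ := shaUnboundedOfCorank_holds W p hne (max n₀ 1)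
  exact hn₀ (max n₀ 1) (le_max_left _ _)
    (hSh W p h5 hgood hord hirr (max n₀ 1) (le_max_right _ _) ⟨σ, hσ⟩)

/-- **The Ш-half is discharged on route ShadowIsolation by its own cruxes #2, #3** (surjective ⇒
irreducible). [folklore] -/
theorem shaCotorsionBigImage_of_shadowIsolation
    (hIso : ShadowIsolation.IsolationOfAccidentalZeros) (hSh : ShadowIsolation.PhantomShadow) :
    Statement.stub_shaCotorsionBigImage :=
  fun W _ _ p _ h5 hgood hord hsurj _ =>
    shaCotorsion_irreducible_of_shadowIsolation hIso hSh W p h5 hgood hord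
      (irreducible_of_surjective W p hsurj)

/-- **The Ш-half is discharged on route SelmerRank by its crux #5 `SelmerRankShaPFinite`**
(stmt-0132): a finite `Ш[p^∞]` has corank `0` (`Literature.BSD.shaCorank_eq_zero_of_finite`, tree
theorem). [cite: GreenbergLNM1716, §1] -/
theorem shaCotorsionBigImage_of_shaPFinite (hSha : SelmerRank.SelmerRankShaPFinite) :
    Statement.stub_shaCotorsionBigImage :=
  fun W _ _ p _ _ _ _ _ _ => Literature.BSD.shaCorank_eq_zero_of_finite W p (hSha W p)

/-- **One-prime Selmer cap from TangentCone's `EdgeDecay ∧ EdgeCap`** (verbatim the surjective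
branch of that route's certified `closes`, stopped at the inequality): a curve with SOME big-image
good ordinary prime `≥ 5` and `r_an ≥ 2` has a big-image good ordinary prime `q ≥ 5` (the
admissible prime EdgeDecay returns) with `corank_q ≤ r_an`. [cite: GreenbergStevens1993, p. 413] -/
theorem selmerCap_of_edge (hE : TangentCone.EdgeDecay) (hC : TangentCone.EdgeCap) :
    ∀ (V : WeierstrassCurve ℚ) [V.IsElliptic] [V.IsGloballyMinimal],
      (∃ (p₀ : ℕ) (_ : Fact p₀.Prime), 5 ≤ p₀ ∧ V.HasGoodReductionAtPrime p₀ ∧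
          ¬ (p₀ : ℤ) ∣ V.frobeniusTrace p₀ ∧ V.HasSurjectiveModNGaloisRep p₀) →
      2 ≤ V.analyticRank →
        ∃ (q : ℕ) (_ : Fact q.Prime), 5 ≤ q ∧ V.HasGoodReductionAtPrime q ∧
          ¬ (q : ℤ) ∣ V.frobeniusTrace q ∧ V.HasSurjectiveModNGaloisRep q ∧
            V.selmerCorank q ≤ V.analyticRank := by
  intro V _ _ hex h2
  obtain ⟨hN, p, hp, h5', hgood', hord', hna, hsurj', hBr, a, b, hb, hab, hJ⟩ := hE V h2 hex
  obtain ⟨J, C₁, hcap⟩ := hC V hN p h5' hgood' hord' hna hsurj' hBr a b hb hab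
  obtain ⟨C₂, hm⟩ := hJ J
  have hp1 : (1 : ℝ) < (p : ℝ) := by exact_mod_cast hp.out.one_lt
  have hp0 : (0 : ℝ) < (p : ℝ) := lt_trans zero_lt_one hp1
  have key : ∀ m : ℕ, V.selmerCorank p * (1 + m) ≤ V.analyticRank * (m + 1) + (C₁ + C₂) := by
    intro m
    obtain ⟨k, g, ι, s, hdiv, hkJ, hs, hnew, hordg, hcong, hall⟩ := hm m
    have hdiv' : (2 * b * (p - 1) : ℤ) ∣ (k - 2) := (Dvd.intro _ rfl).trans hdiv
    obtain ⟨j, hjodd, hj3, hjJ, hcapj⟩ := hcap k g ι s hdiv' hkJ hs hnew hordg hcong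
    obtain ⟨hR, hlow⟩ := hall j hjodd hj3 hjJ
    have hup := hcapj hR
    have hk0 : (k - 2) ≠ 0 := by omega
    have hpm : ((p : ℤ) ^ m) ∣ (k - 2) := (Dvd.intro_left _ rfl).trans hdiv
    have hmv : m ≤ padicValInt p (k - 2) := by
      rcases (padicValInt_dvd_iff m (k - 2)).mp hpm with h | h
      · exact absurd h hk0
      · exact h
    set x : ℝ := ‖ι ⟨_, hR⟩‖ with hx
    have hx0 : 0 ≤ x := norm_nonneg _
    set e₁ : ℕ := V.selmerCorank p * (1 + padicValInt p (k - 2)) with he₁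
    set e₂ : ℕ := V.analyticRank * (m + 1) + C₂ with he₂
    have hpow : (p : ℝ) ^ e₁ ≤ (p : ℝ) ^ (C₁ + e₂) := by
      calc (p : ℝ) ^ e₁ = (p : ℝ) ^ e₁ * 1 := by ring
        _ ≤ (p : ℝ) ^ e₁ * (x * (p : ℝ) ^ e₂) :=
            mul_le_mul_of_nonneg_left hlow (pow_nonneg hp0.le _)
        _ = (x * (p : ℝ) ^ e₁) * (p : ℝ) ^ e₂ := by ring
        _ ≤ (p : ℝ) ^ C₁ * (p : ℝ) ^ e₂ :=
            mul_le_mul_of_nonneg_right hup (pow_nonneg hp0.le _)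
        _ = (p : ℝ) ^ (C₁ + e₂) := (pow_add (p : ℝ) C₁ e₂).symm
    have hexp : e₁ ≤ C₁ + e₂ := (pow_le_pow_iff_right₀ hp1).mp hpow
    have hmono : V.selmerCorank p * (1 + m) ≤ e₁ :=
      Nat.mul_le_mul_left _ (by omega)
    omega
  have hUB : V.selmerCorank p ≤ V.analyticRank := by
    have hk := key (C₁ + C₂)
    by_contra hlt
    push Not at hlt
    have h1 : (V.analyticRank + 1) * (1 + (C₁ + C₂)) ≤ V.selmerCorank p * (1 + (C₁ + C₂)) :=
      Nat.mul_le_mul_right _ hlt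
    nlinarith
  exact ⟨p, hp, h5', hgood', hord', hsurj', hUB⟩

/-- **NO-EXCESS is discharged by TangentCone's `EdgeDecay ∧ EdgeCap` alone** (no Ш input needed
for the RANK bound: `rank ≤ corank_q ≤ r_an` at the admissible prime). [cite: GreenbergStevens1993, p. 413] -/
theorem noExcessRankBigImage_of_edge (hE : TangentCone.EdgeDecay) (hC : TangentCone.EdgeCap) :
    Statement.stub_noExcessRankBigImage := by
  intro W _ _ p hp h5 hgood hord hsurj h2
  obtain ⟨q, hq, -, -, -, -, hcap⟩ := selmerCap_of_edge hE hC W ⟨p, hp, h5, hgood, hord, hsurj⟩ h2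
  have hid := W.selmerCorank_eq_mordellWeilRank_add_holds q
  omega

/-- **Net debt of the crux inside route ShadowIsolation**: its own cruxes `Iso`, `Shadow` + the
sibling item `SqueezeUB` (stmt-0145/0496) + the GZK named fact give the crux. [folklore] -/
theorem selmerRankUB_of_shadowIsolation_items
    (hIso : ShadowIsolation.IsolationOfAccidentalZeros) (hSh : ShadowIsolation.PhantomShadow)
    (hSq : Squeeze.SqueezeUB)
    (hGZK : Literature.NumberTheory.EllipticCurves.rank_eq_analyticRank_of_analyticRank_le_one) :
    SelmerRankUB :=
  SelmerRankUB_of (gzkSelmerCell_of_fact hGZK) (noExcessRankBigImage_of_squeezeUB hSq)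
    (shaCotorsionBigImage_of_shadowIsolation hIso hSh)

/-- **Net debt inside route ShadowIsolation, TangentCone form**: `Iso`, `Shadow` + TangentCone's
`EdgeDecay`, `EdgeCap`, `RankLeOne` give the crux (no `SqueezeUB`, no `SelmerRankShaPFinite`).
[folklore] -/
theorem selmerRankUB_of_shadowIsolation_edge
    (hIso : ShadowIsolation.IsolationOfAccidentalZeros) (hSh : ShadowIsolation.PhantomShadow)
    (hE : TangentCone.EdgeDecay) (hC : TangentCone.EdgeCap) (hR1 : TangentCone.RankLeOne) :
    SelmerRankUB :=
  SelmerRankUB_of (gzkSelmerCell_of_rankLeOne hR1) (noExcessRankBigImage_of_edge hE hC)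
    (shaCotorsionBigImage_of_shadowIsolation hIso hSh)

/-- **Net debt inside route SelmerRank**: its crux `SelmerRankShaPFinite` (stmt-0132) + `SqueezeUB`
+ the GZK named fact give the crux under that route's decl name. [folklore] -/
theorem selmerRankUB_of_selmerRank_items (hSha : SelmerRank.SelmerRankShaPFinite)
    (hSq : Squeeze.SqueezeUB)
    (hGZK : Literature.NumberTheory.EllipticCurves.rank_eq_analyticRank_of_analyticRank_le_one) :
    SelmerRank.SelmerRankUB :=
  SelmerRankUB_ofSelmerRank (gzkSelmerCell_of_fact hGZK) (noExcessRankBigImage_of_squeezeUB hSq)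
    (shaCotorsionBigImage_of_shaPFinite hSha)

/-- **Conversely, the crux returns `SqueezeUB` for NON-CM curves** (in analytic rank `≥ 2`; through
the PROVED Serre supply `exists_goodOrdinary_surjective_of_not_hasCM`): so on a route carrying the
Ш-half the crux and "no excess rank for non-CM curves" are the same open problem. CM curves are
outside the crux's scope. [cite: Serre1972, §4.2 Théorème 2] -/
theorem squeezeUB_nonCM_of_selmerRankUB (hUB : SelmerRankUB) :
    ∀ (W : WeierstrassCurve ℚ) [W.IsElliptic] [W.IsGloballyMinimal], ¬ W.HasCM →
      2 ≤ W.analyticRank → W.mordellWeilRank ≤ W.analyticRank := by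
  intro W _ _ hW h2
  -- the Serre supply, PROVED in tree (same five lines as
  -- `Theorems.exists_goodOrdinary_surjective_of_not_hasCM`): open image threshold + infinitely many
  -- good ordinary primes
  obtain ⟨p₀, hp₀⟩ := Literature.NumberTheory.EllipticCurves.serre_open_image_holds W hW
  obtain ⟨p, ⟨hp, hgood, hord⟩, hlt⟩ :=
    (WeierstrassCurve.infinite_goodOrdinaryPrimes_holds W).exists_gt (max p₀ 4)
  have h5 : 5 ≤ p := by
    have := le_max_right p₀ 4
    omega
  have hle : p₀ ≤ p := by
    have := le_max_left p₀ 4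
    omega
  exact noExcessRankBigImage_of_selmerRankUB hUB W p h5 hgood hord (hp₀ p hp.out hle) h2

end Discharges

end Summit.BirchSwinnertonDyer.BirchSwinnertonDyer.Cruxes.SelmerRankUB.GreenbergSplit
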